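import Mathlib
import Summits.ResolutionOfSingularities.ResolutionOfSingularities.Theorems.RadicialJungCleanModelsCleanPermissibleSeq
import Summits.ResolutionOfSingularities.ResolutionOfSingularities.Theorems.RadicialJungCleanModelsCleanRegTransport
import Literature.AlgebraicGeometry.Resolution.MarkedIdealsEtale
import HarnessLib

/-!
# Route `RadicialJung`, crux `CleanModels` (stmt-ResolutionOfSingularities-15917), line `Sketch` rev 18, stub 4e
# `stub_cleanPrincipalization3`: TRANSPORT of clean-permissibility along local isomorphisms

API for the clean patching / extension step (W1 of the work plan in `Cruxes/CleanModels/Lines/Sketch-memo-4e-cleanPermissible.md` §7: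
the clean twins of `MarkedTransferCampaignW46ThreefoldsGammaFreeGlobal{Local,Etale,Patching}`): the predicate `CleanPermissibleAt`
(✓ p683310) only depends on the local ring, its reading in the function field and the centre ideal UP TO ISOMORPHISM, so it moves
along open immersions / étale maps / any morphism with an isomorphic stalk (the way ✓ `CleanRegAt.functionFieldMap_of_isIso_stalkMap`
moves `CleanRegAt`):

* `CleanPermissibleAt.of_ringEquiv` — along `e : R ≃ R'` compatible with the readings, the centre ideal becoming `I.map e`;
* `CleanPermissibleAt.map` — along an injective map of the target field (the representative is carried along);
* `CleanPermissibleAt.functionFieldMap_of_isIso_stalkMap` — for a dominant `f : X → Y` of integral schemes whose stalk map at `x` is an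
  isomorphism and an ideal sheaf `J` on `Y`: clean-permissible at `f x` for `J_{f x}` ⇒ clean-permissible at `x` for `(J𝒪_X)_x`
  (`stalkIdeal_comap_eq_map`) and the transform `f^♯ G`.

Honest framing: OURS, plumbing; nothing here proves resolution in characteristic `p` or any case of `CleanModels`.
-/

noncomputable section

set_option linter.dupNamespace false -- mandated namespace of this single-conjunct summit

open IsLocalRing CategoryTheory AlgebraicGeometry TopologicalSpace
open Literature.AlgebraicGeometry.Resolution Literature.AlgebraicGeometry.Motives

namespace Summit.ResolutionOfSingularities.ResolutionOfSingularities.Theorems.RadicialJung.CleanModels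

namespace CleanPermissibleAt

variable {p : ℕ}

/-- **Clean-permissibility along a ring isomorphism of the local ring** compatible with the readings in `F`: the regular system of
parameters, the unit and the representative are carried along `e`, the centre ideal becomes `I.map e`. [folklore] -/
theorem of_ringEquiv {R R' F : Type*} [CommRing R] [CommRing R'] [CommRing F] (e : R ≃+* R') {f : R →+* F} {f' : R' →+* F}
    (hf : ∀ x, f' (e x) = f x) {G : F} {I : Ideal R} (h : CleanPermissibleAt p f G I) :
    CleanPermissibleAt p f' G (I.map (e : R →+* R')) := by
  obtain ⟨hreg, n, l, c, w, hspan, hdim, hcI, cc, hcc, hform⟩ := h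
  haveI : IsRegularLocalRing R' := IsRegularLocalRing.of_ringEquiv e
  have happ : Fin.append (fun k => e (c k)) (fun m => e (w m)) = e ∘ Fin.append c w := by
    funext i
    refine Fin.addCases (fun k => ?_) (fun m => ?_) i
    · simp
    · simp
  refine ⟨this, n, l, fun k => e (c k), fun m => e (w m), ?_, ?_, ?_, cc, hcc, ?_⟩
  · rw [happ, Set.range_comp, ← Ideal.map_span, hspan]
    exact map_maximalIdeal_ringEquiv e
  · rw [ringKrullDim_eq_of_ringEquiv e.symm, hdim]
  · rw [show (fun k => e (c k)) = e ∘ c from rfl, Set.range_comp, ← Ideal.map_span, hcI]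
    rfl
  · rcases hform with ⟨a, b, u, hu, hab, hX⟩ | ⟨u, hu, hX, hup⟩
    · refine Or.inl ⟨a, b, e u, hu.map e, hab, ?_⟩
      rw [hX, ← hf]
      simp [map_mul, map_prod, map_pow]
    · refine Or.inr ⟨e u, hu.map e, by rw [hX, hf], fun c' => ?_⟩
      have : e u - c' ^ p = e (u - e.symm c' ^ p) := by simp [map_sub, map_pow]
      rw [this, mem_maximalIdeal_ringEquiv_iff]
      exact hup _

/-- `CleanPermissibleAt` only depends on the reading map as a function. [folklore] -/
theorem congr_hom {R F : Type*} [CommRing R] [CommRing F] {f f' : R →+* F} (hf : ∀ x, f' x = f x) {G : F} {I : Ideal R}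
    (h : CleanPermissibleAt p f G I) : CleanPermissibleAt p f' G I := by
  have h1 := h.of_ringEquiv (RingEquiv.refl R) (f' := f') (fun x => hf x)
  rwa [show I.map ((RingEquiv.refl R : R ≃+* R) : R →+* R) = I from Ideal.map_id I] at h1

/-- **Clean-permissibility pushes forward along an injective map of the target ring** (the representative `∑ cⱼ^p G^j` is carried
along; injectivity keeps it non-trivial). [folklore] -/
theorem map {R F F' : Type*} [CommRing R] [CommRing F] [CommRing F'] {f : R →+* F} (ι : F →+* F')
    (hι : Function.Injective ι) {G : F} {I : Ideal R} (h : CleanPermissibleAt p f G I) :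
    CleanPermissibleAt p (ι.comp f) (ι G) I := by
  obtain ⟨hreg, n, l, c, w, hspan, hdim, hcI, cc, ⟨j, hj, hcj⟩, hform⟩ := h
  have hsum : (∑ i : Fin p, ι (cc i) ^ p * ι G ^ (i : ℕ)) = ι (∑ i : Fin p, cc i ^ p * G ^ (i : ℕ)) := by
    simp [map_sum, map_mul, map_pow]
  refine ⟨hreg, n, l, c, w, hspan, hdim, hcI, fun i => ι (cc i), ⟨j, hj, fun h0 => hcj (hι (by rw [map_zero]; exact h0))⟩, ?_⟩
  rcases hform with ⟨a, b, u, hu, hab, hX⟩ | ⟨u, hu, hX, hup⟩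
  · exact Or.inl ⟨a, b, u, hu, hab, by rw [hsum, hX]; rfl⟩
  · exact Or.inr ⟨u, hu, by rw [hsum, hX]; rfl, hup⟩

/-- **Clean-permissibility ascends along a local isomorphism of integral schemes**: if `f : X → Y` is dominant, its stalk map at `x` is an
isomorphism, and the line of `G` is clean-permissible at `f x` for the stalk of the ideal sheaf `J`, then the line of `f^♯ G` is
clean-permissible at `x` for the stalk of `J𝒪_X = J.comap f` (`stalkIdeal_comap_eq_map`). The way centres of a clean-permissible
sequence on an open (or étale) chart are seen on the ambient stage. [folklore] -/
theorem functionFieldMap_of_isIso_stalkMap {X Y : Scheme.{0}} [IsIntegral X] [IsIntegral Y] (f : X ⟶ Y) [IsDominant f]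
    (x : X) [IsIso (f.stalkMap x)] {G : Y.functionField} (J : Y.IdealSheafData)
    (h : CleanPermissibleAt p (algebraMap (Y.presheaf.stalk (f x)) Y.functionField) G (stalkIdeal J (f x))) :
    CleanPermissibleAt p (algebraMap (X.presheaf.stalk x) X.functionField) (RatFn.functionFieldMap f G)
      (stalkIdeal (J.comap f) x) := by
  let e : Y.presheaf.stalk (f x) ≃+* X.presheaf.stalk x := (asIso (f.stalkMap x)).commRingCatIsoToRingEquiv
  have h1 : CleanPermissibleAt p ((RatFn.functionFieldMap f).comp (algebraMap (Y.presheaf.stalk (f x)) Y.functionField))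
      (RatFn.functionFieldMap f G) (stalkIdeal J (f x)) :=
    h.map (RatFn.functionFieldMap f) (RatFn.functionFieldMap f).injective
  have h2 := h1.of_ringEquiv e (f' := algebraMap (X.presheaf.stalk x) X.functionField) fun t => by
    change algebraMap (X.presheaf.stalk x) X.functionField ((f.stalkMap x) t) =
      RatFn.functionFieldMap f (RatFn.toFunctionField (f x) t)
    rw [RatFn.functionFieldMap_toFunctionField]
  rwa [stalkIdeal_comap_eq_map f J x]

end CleanPermissibleAt

end Summit.ResolutionOfSingularities.ResolutionOfSingularities.Theorems.RadicialJung.CleanModels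

end
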